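import Summits.FinalStateConjecture.FinalStateConjecture.Theorems.PhotonSphereChannelsChannelsResolveTameDevelopmentsRExhaustion
import Summits.FinalStateConjecture.FinalStateConjecture.Theorems.PhotonSphereChannelsChannelsResolveTameDevelopmentsRSilenceReduction
import Summits.FinalStateConjecture.FinalStateConjecture.Theorems.PhotonSphereChannelsChannelsResolveTameDevelopmentsRTotalEnergyConservation

/-!
# Route PhotonSphereChannels — late silence at ONE apex empties its solid forward cone

Helper file `--supports stmt-FinalStateConjecture-17430` (crux `ChannelsResolveTameDevelopmentsR`, K2R-T2):
the FIRST LEMMA of the crux-ideate round-2 card `dark-future-exactness`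
(`Cruxes/ChannelsResolveTameDevelopmentsR/Ideas/dark-future-exactness.md`; typed as
`Cruxes/…/SketchIdeator5.lean : Ideator5G1.LateSilentConeIsEmpty`), the 1+1 Regge–Wheeler shadow of
"zero scattering data on `𝓗⁺ ∪ 𝓘⁺` to the future of a sphere-cone pair ⇒ nothing there", proved over the
landed vocabulary `ReggeWheeler.{energyDensity, IsSolution, exteriorEnergy, channelEnergy, totalEnergy}` and
lead 0's chain (`RW.channelEnergy_atTop_eq_iInf`, `RW.totalEnergy_eq_exteriorEnergy_shift_add`):

* `RW.coneInterior_eq_zero_of_channelEnergy_eq` — for a global `C²` solution of FINITE energy (`V ≥ 0`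
  differentiable): if the forward channel energy of `ψ(B + ·)` through the bare light cone about `xc` IS
  the total energy, then the energy inside the cone, `∫_{xc−t}^{xc+t} e(B+t,·)`, vanishes for every
  `t ≥ 0` (the channel energy is the infimum of the exterior energies, each of which is the total
  energy minus the cone interior — no monotonicity in `t` is needed);
* `RW.energyDensity_eq_zero_of_channelEnergy_eq` — hence the energy density vanishes on the closed solid
  cone `{|x − xc| ≤ t}` (continuity), and, for `V > 0`,
* `RW.eq_zero_of_channelEnergy_eq` — `ψ(B + t, x) = 0` for `|x − xc| ≤ t` (the apex itself by continuity
  from inside the cone);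
* `RW.lateSilentConeIsEmpty` — the card's statement verbatim (Regge–Wheeler instance, `s ≤ ℓ`).

Complementary to the landed all-apex statement `RW.futureSilentWavesVanish_of_exhaustion` (silence at EVERY
centre + exhaustion ⇒ `ψ ≡ 0`): one apex, local conclusion.  No definitions. [folklore]
-/

namespace Summit.FinalStateConjecture.FinalStateConjecture.Theorems

-- every `Summit.FinalStateConjecture.FinalStateConjecture.…` name repeats the summit = sub-problem
-- segment (D-0017 layout), as in every landed `…Theorems` file of this route
set_option linter.dupNamespace false

open MeasureTheory Set Filter Topology intervalIntegral
open Literature.Geometry.Lorentzian Literature.Geometry.Lorentzian.ReggeWheeler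

noncomputable section

namespace RW

section General

variable {V : ℝ → ℝ} {ψ : ℝ → ℝ → ℝ}

/-- **Full forward channel energy ⇒ empty cone interior (energy form).** For `V ≥ 0` differentiable and
a global `C²` solution of finite total energy: if the forward channel energy of `ψ(B + ·)` through the
bare light cone about `xc` equals the total energy, then `∫_{xc−t}^{xc+t} e(B+t,·) = 0` for every
`t ≥ 0`. [folklore] -/
theorem coneInterior_eq_zero_of_channelEnergy_eq (hV : Differentiable ℝ V) (hV0 : ∀ x, 0 ≤ V x)
    (hψ : IsSolution V ψ) (hfin : totalEnergy V ψ 0 < ⊤) {xc B : ℝ}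
    (hch : channelEnergy V xc 0 (fun s y ↦ ψ (B + s) y) atTop = totalEnergy V ψ 0)
    {t : ℝ} (ht : 0 ≤ t) :
    ∫ x in (xc - t)..(xc + t), energyDensity V ψ (B + t) x = 0 := by
  set K := ∫ x in (xc - t)..(xc + t), energyDensity V ψ (B + t) x with hK
  have hK0 : 0 ≤ K :=
    intervalIntegral.integral_nonneg (by linarith) fun x _ ↦ energyDensity_nonneg ψ _ (hV0 x)
  -- `E = E_ext(t) + ofReal K`
  have hsplit := totalEnergy_eq_exteriorEnergy_shift_add hV hV0 hψ xc B ht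
  -- `E ≤ E_ext(t)` (the channel energy is the infimum of the exterior energies over `t ≥ 0`)
  have hle : totalEnergy V ψ 0 ≤ exteriorEnergy V xc 0 (fun s y ↦ ψ (B + s) y) t := by
    rw [← hch, channelEnergy_atTop_eq_iInf hV hV0 (IsSolution.shift hψ B) xc le_rfl]
    exact iInf₂_le t (mem_Ici.2 ht)
  have hge : exteriorEnergy V xc 0 (fun s y ↦ ψ (B + s) y) t ≤ totalEnergy V ψ 0 :=
    hsplit ▸ le_self_add
  have hEq : exteriorEnergy V xc 0 (fun s y ↦ ψ (B + s) y) t = totalEnergy V ψ 0 := le_antisymm hge hle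
  rw [hEq] at hsplit
  -- cancel the finite total energy
  have hofReal : ENNReal.ofReal K = 0 := by
    have h : totalEnergy V ψ 0 + ENNReal.ofReal K = totalEnergy V ψ 0 + 0 := by
      rw [add_zero]
      exact hsplit.symm
    exact (ENNReal.add_right_inj hfin.ne).1 h
  exact le_antisymm (ENNReal.ofReal_eq_zero.1 hofReal) hK0

/-- **… hence the energy density vanishes on the closed solid cone.** Under the same hypotheses,
`e[ψ](B + t, x) = 0` whenever `|x − xc| ≤ t` (for `t > 0` by continuity of the non-negative density on
`[xc − t, xc + t]`; for `t = 0` the cone is the apex, handled by continuity in `t`). [folklore] -/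
theorem energyDensity_eq_zero_of_channelEnergy_eq (hV : Differentiable ℝ V) (hV0 : ∀ x, 0 ≤ V x)
    (hψ : IsSolution V ψ) (hfin : totalEnergy V ψ 0 < ⊤) {xc B : ℝ}
    (hch : channelEnergy V xc 0 (fun s y ↦ ψ (B + s) y) atTop = totalEnergy V ψ 0)
    {t x : ℝ} (ht : 0 < t) (hx : |x - xc| ≤ t) :
    energyDensity V ψ (B + t) x = 0 := by
  have hK := coneInterior_eq_zero_of_channelEnergy_eq hV hV0 hψ hfin hch ht.le
  have hab : xc - t < xc + t := by linarith
  have hxI : x ∈ Icc (xc - t) (xc + t) := by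
    rw [abs_le] at hx
    exact ⟨by linarith [hx.1], by linarith [hx.2]⟩
  have hcont : Continuous fun y ↦ energyDensity V ψ (B + t) y :=
    continuous_energyDensity_slice hV hψ.1 (B + t)
  have hnn : ∀ y, 0 ≤ energyDensity V ψ (B + t) y := fun y ↦ energyDensity_nonneg ψ _ (hV0 y)
  by_contra hne
  have hpos : 0 < energyDensity V ψ (B + t) x := lt_of_le_of_ne (hnn x) (Ne.symm hne)
  have hlt : (∫ y in (xc - t)..(xc + t), (0 : ℝ)) < ∫ y in (xc - t)..(xc + t), energyDensity V ψ (B + t) y :=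
    integral_lt_integral_of_continuousOn_of_le_of_exists_lt hab continuousOn_const hcont.continuousOn
      (fun y _ ↦ hnn y) ⟨x, hxI, hpos⟩
  rw [intervalIntegral.integral_zero, hK] at hlt
  exact lt_irrefl _ hlt

/-- **Full forward channel energy at one apex ⇒ the solution vanishes on the closed solid forward cone
of that apex** (`V > 0` differentiable, global `C²` solution of finite energy): if
`channelEnergy V xc 0 (ψ(B + ·)) atTop = totalEnergy V ψ 0`, then `ψ (B + t) x = 0` for all `t ≥ 0`,
`|x − xc| ≤ t`. [folklore] -/
theorem eq_zero_of_channelEnergy_eq (hV : Differentiable ℝ V) (hVpos : ∀ x, 0 < V x)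
    (hψ : IsSolution V ψ) (hfin : totalEnergy V ψ 0 < ⊤) {xc B : ℝ}
    (hch : channelEnergy V xc 0 (fun s y ↦ ψ (B + s) y) atTop = totalEnergy V ψ 0)
    {t x : ℝ} (ht : 0 ≤ t) (hx : |x - xc| ≤ t) :
    ψ (B + t) x = 0 := by
  have hV0 : ∀ y, 0 ≤ V y := fun y ↦ (hVpos y).le
  -- positive times: the energy density vanishes, and `V > 0` kills `ψ`
  have hposT : ∀ {τ y : ℝ}, 0 < τ → |y - xc| ≤ τ → ψ (B + τ) y = 0 := by
    intro τ y hτ hy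
    have he := energyDensity_eq_zero_of_channelEnergy_eq hV hV0 hψ hfin hch hτ hy
    unfold energyDensity at he
    have h3 : V y * ψ (B + τ) y ^ 2 = 0 := by
      nlinarith [sq_nonneg (deriv (fun σ ↦ ψ σ y) (B + τ)), sq_nonneg (deriv (ψ (B + τ)) y),
        mul_nonneg (hV0 y) (sq_nonneg (ψ (B + τ) y))]
    rcases mul_eq_zero.1 h3 with h | h
    · exact absurd h (hVpos y).ne'
    · exact pow_eq_zero_iff (n := 2) (by norm_num) |>.1 h
  rcases ht.lt_or_eq with hlt | heq
  · exact hposT hlt hx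
  · -- the apex: `t = 0`, `x = xc`; continuity of `τ ↦ ψ (B + τ) xc` from the right
    subst heq
    have hxc : x = xc := by
      have h := abs_nonpos_iff.1 hx
      linarith [sub_eq_zero.1 h]
    subst hxc
    set g : ℝ → ℝ := fun τ ↦ ψ (B + τ) x with hg
    have hgc : Continuous g :=
      hψ.1.continuous.comp ((continuous_const.add continuous_id).prodMk continuous_const)
    have h1 : Tendsto g (𝓝[>] 0) (𝓝 (g 0)) := hgc.continuousAt.tendsto.mono_left nhdsWithin_le_nhds
    have h2 : Tendsto g (𝓝[>] 0) (𝓝 0) := by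
      refine tendsto_const_nhds.congr' ?_
      filter_upwards [self_mem_nhdsWithin] with τ hτ
      exact (hposT (mem_Ioi.1 hτ) (by simp [le_of_lt (mem_Ioi.1 hτ)])).symm
    have h := tendsto_nhds_unique h1 h2
    simpa [hg] using h

end General

/-! ### Regge–Wheeler instance: the card's first lemma verbatim -/

section ReggeWheelerInstance

/-- **Late silence empties the forward cone** — the first lemma `Ideator5G1.LateSilentConeIsEmpty` of the
crux-ideate card `dark-future-exactness` (crux stmt-FinalStateConjecture-17430), verbatim: for `M > 0`,
a tortoise radius function, `s ≤ ℓ`, a global `C²` Regge–Wheeler solution `ψ` of finite energy and ANY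
apex `(B, x₀)`, if the forward channel energy of `ψ(B + ·)` through the bare light cone about `x₀` is
the whole energy (nothing is radiated to `𝓘⁺` after retarded time `B − x₀` nor into `𝓗⁺` after
advanced time `B + x₀`), then `ψ` vanishes on the closed solid forward cone `{|x − x₀| ≤ t}` of that
apex.  (`0 < M` is implied by `IsTortoiseRadius` and not used.) [folklore] -/
theorem lateSilentConeIsEmpty :
    ∀ (M : ℝ), 0 < M → ∀ (r : ℝ → ℝ) (xc : ℝ), IsTortoiseRadius M r xc →
      ∀ (s ℓ : ℕ), s ≤ ℓ → ∀ ψ : ℝ → ℝ → ℝ, IsRWSolution M s ℓ r ψ →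
        totalEnergy (linePotential M s ℓ r) ψ 0 < (⊤ : ENNReal) →
          ∀ (B x₀ : ℝ),
            channelEnergy (linePotential M s ℓ r) x₀ 0 (fun t x ↦ ψ (B + t) x) atTop =
                totalEnergy (linePotential M s ℓ r) ψ 0 →
              ∀ (t x : ℝ), 0 ≤ t → |x - x₀| ≤ t → ψ (B + t) x = 0 :=
  fun _ _ _ _ hr _ _ hsℓ _ hψ hfin _ _ hch _ _ ht hx ↦
    eq_zero_of_channelEnergy_eq (differentiable_linePotential hr _ _) (linePotential_pos hr hsℓ) hψ
      hfin hch ht hx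

end ReggeWheelerInstance

/-! ### Appendix (same seat): the hypothesis in cone-interior form

The hypothesis `channelEnergy V xc 0 (ψ(B + ·)) atTop = totalEnergy V ψ 0` above says that no energy
ever enters the solid forward cone of the apex.  The energy inside that cone is NON-DECREASING in `t`
(it is the flux swept through the two null sheets, `RW.integral_coneInterior_eq_flux`, whose integrand
is non-negative), so the hypothesis is equivalent to the asymptotic statement that the cone-interior
energy is not bounded away from zero at late times (`RW.channelEnergy_eq_totalEnergy_iff`) — the
"zero future boundary terms" form in which the card's step (3) (energy identity on the characteristic
rectangle `{u ≥ u₀, v ≥ v₀}`) is phrased. -/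

section ConeInteriorForm

variable {V : ℝ → ℝ} {ψ : ℝ → ℝ → ℝ}

/-- **The energy inside the light cone of `(B, xc)` is non-decreasing in `t ≥ 0`** (the cone expands at
the speed of light; energy only enters). [folklore] -/
theorem coneInterior_mono (hV : Differentiable ℝ V) (hV0 : ∀ x, 0 ≤ V x) (hψ : IsSolution V ψ)
    (xc B : ℝ) {s t : ℝ} (hs : 0 ≤ s) (hst : s ≤ t) :
    ∫ x in (xc - s)..(xc + s), energyDensity V ψ (B + s) x
      ≤ ∫ x in (xc - t)..(xc + t), energyDensity V ψ (B + t) x := by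
  rw [integral_coneInterior_eq_flux hV hψ xc B s, integral_coneInterior_eq_flux hV hψ xc B t]
  have h1 := continuous_inwardDensity hV hψ.1 1
  have h2 := continuous_inwardDensity hV hψ.1 (-1)
  have hc1 : Continuous fun σ : ℝ ↦ ((B + σ, xc + σ) : ℝ × ℝ) := by fun_prop
  have hc2 : Continuous fun σ : ℝ ↦ ((B + σ, xc - σ) : ℝ × ℝ) := by fun_prop
  have hGc := (h1.comp hc1).add (h2.comp hc2)
  refine intervalIntegral.integral_mono_interval le_rfl hs hst (Eventually.of_forall fun σ ↦ ?_)
    (hGc.intervalIntegrable _ _)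
  have hV1 := hV0 (xc + σ)
  have hV2 := hV0 (xc - σ)
  positivity

/-- **Cone-interior energy frequently small at late times ⇒ the forward channel energy is the total
energy** (`V ≥ 0` differentiable, global `C²` solution): if for every `ε > 0` and every `T` there is
`t ≥ T` with `∫_{xc−t}^{xc+t} e(B+t,·) < ε`, then (monotonicity) the cone interior carries no energy at
any time, so every exterior energy — hence their infimum, the channel energy — is the total energy.
[folklore] -/
theorem channelEnergy_eq_totalEnergy_of_coneInterior_small (hV : Differentiable ℝ V)
    (hV0 : ∀ x, 0 ≤ V x) (hψ : IsSolution V ψ) (xc B : ℝ)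
    (h : ∀ ε > (0 : ℝ), ∀ T : ℝ, ∃ t, T ≤ t ∧
      ∫ x in (xc - t)..(xc + t), energyDensity V ψ (B + t) x < ε) :
    channelEnergy V xc 0 (fun s y ↦ ψ (B + s) y) atTop = totalEnergy V ψ 0 := by
  have hK : ∀ s, 0 ≤ s → ∫ x in (xc - s)..(xc + s), energyDensity V ψ (B + s) x = 0 := by
    intro s hs
    have hK0 : 0 ≤ ∫ x in (xc - s)..(xc + s), energyDensity V ψ (B + s) x :=
      intervalIntegral.integral_nonneg (by linarith) fun x _ ↦ energyDensity_nonneg ψ _ (hV0 x)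
    refine le_antisymm (le_of_forall_pos_lt_add fun ε hε ↦ ?_) hK0
    obtain ⟨t, hst, ht⟩ := h ε hε s
    rw [zero_add]
    exact lt_of_le_of_lt (coneInterior_mono hV hV0 hψ xc B hs hst) ht
  have hext : ∀ s, 0 ≤ s →
      exteriorEnergy V xc 0 (fun s' y ↦ ψ (B + s') y) s = totalEnergy V ψ 0 := by
    intro s hs
    have hsplit := totalEnergy_eq_exteriorEnergy_shift_add hV hV0 hψ xc B hs
    rw [hK s hs, ENNReal.ofReal_zero, add_zero] at hsplit
    exact hsplit.symm
  rw [channelEnergy_atTop_eq_iInf hV hV0 (IsSolution.shift hψ B) xc le_rfl]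
  apply le_antisymm
  · exact (iInf₂_le (0 : ℝ) (mem_Ici.2 le_rfl)).trans (hext 0 le_rfl).le
  · exact le_iInf₂ fun s hs ↦ (hext s (mem_Ici.1 hs)).ge

/-- **Cone-interior energy → 0 ⇒ the forward channel energy is the total energy.** [folklore] -/
theorem channelEnergy_eq_totalEnergy_of_coneInterior_tendsto_zero (hV : Differentiable ℝ V)
    (hV0 : ∀ x, 0 ≤ V x) (hψ : IsSolution V ψ) (xc B : ℝ)
    (h : Tendsto (fun t ↦ ∫ x in (xc - t)..(xc + t), energyDensity V ψ (B + t) x) atTop (𝓝 0)) :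
    channelEnergy V xc 0 (fun s y ↦ ψ (B + s) y) atTop = totalEnergy V ψ 0 :=
  channelEnergy_eq_totalEnergy_of_coneInterior_small hV hV0 hψ xc B fun _ hε T ↦ by
    obtain ⟨t, ht⟩ := ((h.eventually (gt_mem_nhds hε)).and (eventually_ge_atTop T)).exists
    exact ⟨t, ht.2, ht.1⟩

/-- **The two forms of late silence at an apex are equivalent** for finite-energy solutions: the forward
channel energy of `ψ(B + ·)` through the bare cone about `xc` is the total energy iff the energy inside
the solid forward cone tends to zero (iff it vanishes identically). [folklore] -/
theorem channelEnergy_eq_totalEnergy_iff (hV : Differentiable ℝ V) (hV0 : ∀ x, 0 ≤ V x)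
    (hψ : IsSolution V ψ) (hfin : totalEnergy V ψ 0 < ⊤) (xc B : ℝ) :
    channelEnergy V xc 0 (fun s y ↦ ψ (B + s) y) atTop = totalEnergy V ψ 0 ↔
      Tendsto (fun t ↦ ∫ x in (xc - t)..(xc + t), energyDensity V ψ (B + t) x) atTop (𝓝 0) := by
  refine ⟨fun hch ↦ ?_, channelEnergy_eq_totalEnergy_of_coneInterior_tendsto_zero hV hV0 hψ xc B⟩
  refine tendsto_const_nhds.congr' ?_
  filter_upwards [eventually_ge_atTop (0 : ℝ)] with t ht
  exact (coneInterior_eq_zero_of_channelEnergy_eq hV hV0 hψ hfin hch ht).symm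

/-- **Late silence empties the forward cone, cone-interior form** (Regge–Wheeler instance, registered
sub-goal `lateSilentConeIsEmpty_coneInteriorForm` of crux stmt-FinalStateConjecture-17430): if the energy
of `ψ` inside the solid forward cone `{|x − x₀| ≤ t}` of the apex `(B, x₀)` tends to zero as `t → ∞`
(zero future boundary terms of the characteristic rectangle `{u ≥ B − x₀, v ≥ B + x₀}`), then `ψ`
vanishes on that closed solid cone. [folklore] -/
theorem lateSilentConeIsEmpty_coneInteriorForm :
    ∀ (M : ℝ) (r : ℝ → ℝ) (xc : ℝ), IsTortoiseRadius M r xc →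
      ∀ (s ℓ : ℕ), s ≤ ℓ → ∀ ψ : ℝ → ℝ → ℝ, IsRWSolution M s ℓ r ψ →
        totalEnergy (linePotential M s ℓ r) ψ 0 < (⊤ : ENNReal) →
          ∀ (B x₀ : ℝ),
            Tendsto (fun t ↦ ∫ x in (x₀ - t)..(x₀ + t),
                energyDensity (linePotential M s ℓ r) ψ (B + t) x) atTop (nhds 0) →
              ∀ (t x : ℝ), 0 ≤ t → |x - x₀| ≤ t → ψ (B + t) x = 0 :=
  fun _ _ _ hr _ _ hsℓ _ hψ hfin B x₀ h _ _ ht hx ↦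
    eq_zero_of_channelEnergy_eq (differentiable_linePotential hr _ _) (linePotential_pos hr hsℓ) hψ hfin
      (channelEnergy_eq_totalEnergy_of_coneInterior_tendsto_zero (differentiable_linePotential hr _ _)
        (fun y ↦ (linePotential_pos hr hsℓ y).le) hψ x₀ B h) ht hx

end ConeInteriorForm

end RW

end

end Summit.FinalStateConjecture.FinalStateConjecture.Theorems
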